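import Summits.BirchSwinnertonDyer.Rank1Residual.X1.CyclotomicZeros
import HarnessLib

/-!
# Route C on the leaf X1 ∩ {r = 0}: `BSD(E,p)` from an arithmetic zero (consumers of
# `X1/CyclotomicZeros.lean`)

HONEST FRAMING (cell `b2b-bsdres`, run/shared/lean/b2b/bsd-rank1-residual/, verbatim in every
file): the goal of the cell is to DELETE the COMBINATION-SHAPED residual classes of the
Birch–Swinnerton-Dyer formula for ALL analytic-rank `≤ 1` elliptic curves over `ℚ` — "full BSD
formula for every rank `≤ 1` curve in class `C`" assembled STRICTLY from published theorems — so
that the rank-`≤ 1` remainder becomes exactly the CONSTRUCTION-SHAPED classes, which are TYPED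
(missing-input `Prop`s), NOT attempted. This is not "finishing BSD". Sub-cell
`b2b-bsdres-eisenstein-p1` (CLASS-OWNERS row "X1 (r=0)"), gen 6: research route; NO CLAIM BEYOND
STATED CLASSES; nothing here changes a label. Theorems only (no definitions).

On the leaf (`RankZero.Leaf W p`: `p` odd good anomalous Eisenstein, type A, `r_an = 0`) the
hypotheses `p ≠ 2`, good ordinary, `E[p]` reducible and `L(E,1) ≠ 0` of
`CyclotomicZeros.mazurMainConjecture_of_cyclotomicFactor(_of_hb2)` hold, and Mazur's main conjecture
is `BSD(E,p)` (`RankZero.Leaf.mazurMainConjecture_iff_bsdp`: Greenberg 4.1, modularity,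
Gross–Zagier–Kolyvagin — all PUBLISHED named facts). Headline:
**`μ_an = 0 ∧ λ_an = 4 ∧ ξ_3 ∣ f_E ∧ 2 + 2·ord_3 #E(ℚ)_tors ≤ ord_3 ∏c_ℓ + 2·ord_3 #Ẽ(𝔽_3) ⇒ BSD(E,3)`**
— 26 of the 169 classes left open by routes P/T on the census `N < 2·10⁴` carry the certificate
(a point of infinite order over `ℚ(ζ_9)⁺`, HOME/b2b-bsdres-eisenstein-p1/routeC/).

References: [GreenbergLNM1716] Thm. 1.2, Prop. 3.10, Thm. 4.1, §5 p. 132; [Wuthrich2014] Thm. 16;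
HOME/b2b-bsdres-eisenstein-p1/X1R0-GAPMAP.md §15.
-/

noncomputable section

open scoped Classical MatrixGroups ModularForm

open PowerSeries CongruenceSubgroup WeierstrassCurve Literature.NumberTheory.EllipticCurves
  Literature.NumberTheory.EllipticCurves.ModularForms
  Literature.NumberTheory.EllipticCurves.Rank1Residual
  Literature.NumberTheory.EllipticCurves.Greenberg1999
  Summit.BirchSwinnertonDyer.BirchSwinnertonDyer.Theorems.Rank1ResidualX1Defs
  Summit.BirchSwinnertonDyer.Rank1Residual.X1.MuLambda
  Summit.BirchSwinnertonDyer.Rank1Residual.X1.MuPart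
  Summit.BirchSwinnertonDyer.Rank1Residual.X1.ParitySqueeze

set_option autoImplicit false

namespace Summit.BirchSwinnertonDyer.Rank1Residual.X1.CyclotomicZeros

/-! ## §4. On the leaf X1 ∩ {r = 0} -/

section Leaf

variable {W : WeierstrassCurve ℚ} [W.IsElliptic] [W.IsGloballyMinimal] {p : ℕ} [Fact p.Prime]

/-- **Route C on the leaf: Mazur's main conjecture** from `AnalyticMuLE W p m`, `MuPartAt W p`,
`λ_an = n ≤ p + 1`, `ξ_p ∣ f_E` and `hb2`. [cite: GreenbergLNM1716, Thm. 1.2, Prop. 3.10, Thm. 4.1 and §5 p. 132]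
[cite: Wuthrich2014, Thm. 16 (p. 397)] -/
theorem Leaf.mazurMainConjecture_of_cyclotomicFactor
    (hW16 : Wuthrich2014.charIdeal_dvd_padicLFunction) (hGr : greenberg_charValue_rankZero)
    (h310 : prop310_selmerCorank_mod_two_eq_lambdaInvariant)
    (hmod : nonempty_modularParametrizationData) (hL : RankZero.Leaf W p)
    {m : ℕ} (hμan : AnalyticMuLE W p m) (hμ : MuPartAt W p) {n : ℕ} (hlam : AnalyticLambdaEq W p n)
    (hξ : CyclotomicFactorAt W p)
    (hb2 : m + 2 + 2 * padicValNat p W.torsionOrder ≤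
      padicValNat p W.tamagawaProduct + 2 * padicValNat p (W.reductionPointCount p))
    (hn : n ≤ p + 1) : MazurMainConjecture W p :=
  have hX := isClassX1_of_classX1 hL.classX1
  CyclotomicZeros.mazurMainConjecture_of_cyclotomicFactor_of_hb2 hW16 hGr h310 hX.two_ne
    hX.hasGoodReductionAtPrime
    hX.not_dvd_frobeniusTrace hX.not_hasIrreducibleModPGaloisRep
    (entireLFunction_one_ne_zero_of_analyticRank_eq_zero hmod W hL.analyticRank_eq_zero)
    hμan hμ hlam hξ hb2 hn

/-- **Route C on the leaf: `BSD(E,p)`** (general form). [cite: GreenbergLNM1716, Thm. 1.2, Prop. 3.10, Thm. 4.1 and §5 p. 132]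
[cite: Wuthrich2014, Thm. 16 (p. 397)] -/
theorem Leaf.bsdp_of_cyclotomicFactor
    (hW16 : Wuthrich2014.charIdeal_dvd_padicLFunction) (hGr : greenberg_charValue_rankZero)
    (h310 : prop310_selmerCorank_mod_two_eq_lambdaInvariant)
    (hmod : nonempty_modularParametrizationData)
    (hGZK : rank_eq_analyticRank_of_analyticRank_le_one) (hL : RankZero.Leaf W p)
    {m : ℕ} (hμan : AnalyticMuLE W p m) (hμ : MuPartAt W p) {n : ℕ} (hlam : AnalyticLambdaEq W p n)
    (hξ : CyclotomicFactorAt W p)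
    (hb2 : m + 2 + 2 * padicValNat p W.torsionOrder ≤
      padicValNat p W.tamagawaProduct + 2 * padicValNat p (W.reductionPointCount p))
    (hn : n ≤ p + 1) : BSDp W p :=
  (RankZero.Leaf.mazurMainConjecture_iff_bsdp hW16 hGr hmod hGZK hL).mp
    (Leaf.mazurMainConjecture_of_cyclotomicFactor hW16 hGr h310 hmod hL hμan hμ hlam hξ hb2 hn)

/-- **Route C, headline at `p = 3`, `μ = 0` member: `μ_an = 0 ∧ λ_an = 4 ∧ ξ_3 ∣ f_E ∧
`2 + 2·ord_3 #E(ℚ)_tors ≤ ord_3 ∏c_ℓ + 2·ord_3 #Ẽ(𝔽_3)` ⇒ BSD(E,3)`** — the 26 open census classes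
with an arithmetic zero and a point over `ℚ(ζ_9)⁺` on file (X1R0-GAPMAP §15). μ-part automatic.
[cite: GreenbergLNM1716, Thm. 1.2, Prop. 3.10, Thm. 4.1 and §5 p. 132 (Conductor = 34, p = 3)]
[cite: Wuthrich2014, Thm. 16 (p. 397)] -/
theorem Leaf.bsdp_three_of_muZero_lamFour_of_cyclotomicFactor {W : WeierstrassCurve ℚ} [W.IsElliptic]
    [W.IsGloballyMinimal] [Fact (3 : ℕ).Prime]
    (hW16 : Wuthrich2014.charIdeal_dvd_padicLFunction) (hGr : greenberg_charValue_rankZero)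
    (h310 : prop310_selmerCorank_mod_two_eq_lambdaInvariant)
    (hmod : nonempty_modularParametrizationData)
    (hGZK : rank_eq_analyticRank_of_analyticRank_le_one) (hL : RankZero.Leaf W 3)
    (hμ0 : AnalyticMuLE W 3 0) (hlam : AnalyticLambdaEq W 3 4) (hξ : CyclotomicFactorAt W 3)
    (hb2 : 2 + 2 * padicValNat 3 W.torsionOrder ≤
      padicValNat 3 W.tamagawaProduct + 2 * padicValNat 3 (W.reductionPointCount 3)) : BSDp W 3 :=
  have hX := isClassX1_of_classX1 hL.classX1
  CyclotomicZeros.Leaf.bsdp_of_cyclotomicFactor hW16 hGr h310 hmod hGZK hL hμ0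
    (muPartAt_of_analyticMuLE_zero hW16 hX.two_ne hX.hasGoodReductionAtPrime
      hX.not_dvd_frobeniusTrace hX.not_hasIrreducibleModPGaloisRep hμ0) hlam hξ
    (by simpa using hb2) (by norm_num)

/-- **Route C without the constant term on the leaf: `λ_an ≤ p − 1 ∧ ξ_p ∣ f_E ∧ μ-part ⇒ BSD(E,p)`**
(e.g. `λ_an = 4` at `p = 5`: a point of infinite order over `ℚ(ζ_25)⁺` closes the pair).
[cite: GreenbergLNM1716, Thm. 1.2 and §5 p. 132] [cite: Wuthrich2014, Thm. 16 (p. 397)] -/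
theorem Leaf.bsdp_of_cyclotomicFactor_of_le_pred
    (hW16 : Wuthrich2014.charIdeal_dvd_padicLFunction) (hGr : greenberg_charValue_rankZero)
    (hmod : nonempty_modularParametrizationData)
    (hGZK : rank_eq_analyticRank_of_analyticRank_le_one) (hL : RankZero.Leaf W p)
    (hμ : MuPartAt W p) {n : ℕ} (hlam : AnalyticLambdaEq W p n) (hξ : CyclotomicFactorAt W p)
    (hn : n ≤ p - 1) : BSDp W p :=
  have hX := isClassX1_of_classX1 hL.classX1
  (RankZero.Leaf.mazurMainConjecture_iff_bsdp hW16 hGr hmod hGZK hL).mp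
    (CyclotomicZeros.mazurMainConjecture_of_cyclotomicFactor hW16 hX.two_ne hX.hasGoodReductionAtPrime
      hX.not_dvd_frobeniusTrace hX.not_hasIrreducibleModPGaloisRep hμ hlam hξ hn)

end Leaf

end Summit.BirchSwinnertonDyer.Rank1Residual.X1.CyclotomicZeros

end
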